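import Literature.AlgebraicGeometry.Frobenioids.ArchimedeanMorphismTypes
import HarnessLib

/-!
# Frobenioids II, Example 3.3 (ii): isotropic and co-angular in `C₀`

Mochizuki, *The geometry of Frobenioids II: poly-Frobenioids*, Kyushu J. Math. **62** (2008)
401–460, §3, Example 3.3 (ii), author's text p. 28 [cite: MochizukiFrdII2008, Ex 3.3 (ii) p.28]:
"By Lemma 3.2, (i), it follows immediately that an object of `C` is isotropic [in the sense of
[Mzk5], Definition 1.2, (iv)] if and only if it is naively isotropic, and that a morphism of `C` is
co-angular [in the sense of [Mzk5], Definition 1.2, (iii)] if and only if it is naively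
co-angular."  PROOF-ONLY file (no definition), for abc-iut-L1-t6's `C₀` (`ArchFrd.C0`,
`C0.IsNaivelyIsotropic`, `C0.IsNaivelyCoAngular`) and found's Def. 1.2 predicates over `C0.toElem`:
both equivalences PROVED for `C₀` (`isIsotropic_iff_isNaivelyIsotropic`,
`isCoAngular_iff_isNaivelyCoAngular`), together with the "shadow" calculus of the angular parts
`Im(A_L^{⊗d}) ↦ (c/|c|) · B^d ⊆ O_ℂ^×` of images of morphisms under composition, and the resulting
description of morphisms of Frobenius type (`isFrobeniusType_iff`).
-/

namespace Literature.AlgebraicGeometry.Frobenioids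

open CategoryTheory Set Function Topology
open scoped Pointwise

noncomputable section

namespace ArchFrd

namespace C0

variable {X Y Z : C0}

/-! ### Shadows: unit parts of subsets of `ℂ^×` -/

/-- `(c · S)^n = c^n · S^n` in the commutative group `ℂ^×`. [cite: MochizukiFrdII2008, Ex 3.3 (i) p.27] -/
theorem smul_set_pow' (a : ℂˣ) (s : Set ℂˣ) (n : ℕ) : (a • s) ^ n = a ^ n • s ^ n := by
  induction n with
  | zero => simp
  | succ n ih =>
    rw [pow_succ, ih, pow_succ, pow_succ]
    ext x
    simp only [Set.mem_mul, Set.mem_smul_set, smul_eq_mul]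
    constructor
    · rintro ⟨_, ⟨y, hy, rfl⟩, _, ⟨z, hz, rfl⟩, rfl⟩
      exact ⟨y * z, ⟨y, hy, z, hz, rfl⟩, mul_mul_mul_comm _ _ _ _⟩
    · rintro ⟨_, ⟨y, hy, z, hz, rfl⟩, rfl⟩
      exact ⟨a ^ n * y, ⟨y, hy, rfl⟩, a * z, ⟨z, hz, rfl⟩, (mul_mul_mul_comm _ _ _ _).symm⟩

/-- Unit parts of a dilate: `(c · T)/|·| = (c/|c|) · (T/|·|)`. [cite: MochizukiFrdII2008, Def 3.1 (ii) p.23] -/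
theorem image_unitPart_smul (c : ℂˣ) (T : Set ℂˣ) :
    unitPart ℂ '' (c • T) = unitPart ℂ c • unitPart ℂ '' T := by
  ext z
  simp only [Set.mem_image, Set.mem_smul_set, smul_eq_mul]
  constructor
  · rintro ⟨_, ⟨v, hv, rfl⟩, rfl⟩
    exact ⟨unitPart ℂ v, ⟨v, hv, rfl⟩, (unitPart_mul c v).symm⟩
  · rintro ⟨_, ⟨v, hv, rfl⟩, rfl⟩
    exact ⟨c * v, ⟨v, hv, rfl⟩, unitPart_mul c v⟩

/-- Unit parts of a product set. [cite: MochizukiFrdII2008, Def 3.1 (ii) p.23] -/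
theorem image_unitPart_mul (T₁ T₂ : Set ℂˣ) :
    unitPart ℂ '' (T₁ * T₂) = unitPart ℂ '' T₁ * unitPart ℂ '' T₂ := by
  ext z
  simp only [Set.mem_image, Set.mem_mul]
  constructor
  · rintro ⟨_, ⟨v, hv, w, hw, rfl⟩, rfl⟩
    exact ⟨_, ⟨v, hv, rfl⟩, _, ⟨w, hw, rfl⟩, (unitPart_mul v w).symm⟩
  · rintro ⟨_, ⟨v, hv, rfl⟩, _, ⟨w, hw, rfl⟩, rfl⟩
    exact ⟨v * w, ⟨v, hv, w, hw, rfl⟩, unitPart_mul v w⟩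

/-- Unit parts of a power set. [cite: MochizukiFrdII2008, Def 3.1 (iii) p.24] -/
theorem image_unitPart_pow (T : Set ℂˣ) : ∀ n : ℕ,
    unitPart ℂ '' (T ^ (n + 1)) = (unitPart ℂ '' T) ^ (n + 1)
  | 0 => by rw [zero_add, pow_one, pow_one]
  | n + 1 => by rw [pow_succ, pow_succ _ (n + 1), image_unitPart_mul, image_unitPart_pow T n]

/-- The unit part of a Galois twist only depends on the unit part.
[cite: MochizukiFrdII2008, Def 3.1 (iv) p.24] -/
theorem unitPart_galAct (σ : Bool) (u : ℂˣ) :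
    unitPart ℂ (D0.galAct σ u) = unitPart ℂ (D0.galAct σ (unitPart ℂ u : ℂˣ)) := by
  cases σ
  · rw [D0.galAct_false, D0.galAct_false, unitPart_normOne_coe]
  · rw [unitPart_galAct_true, unitPart_galAct_true, unitPart_normOne_coe]

/-- Unit parts of a Galois twist of a set: the twist of the unit parts.
[cite: MochizukiFrdII2008, Def 3.1 (iv) p.24] -/
theorem image_unitPart_act_image {L K : D0} (f : L ⟶ K) (T : Set ℂˣ) :
    unitPart ℂ '' (f.act '' T) =
      (fun z : normOneSubgroup ℂ => unitPart ℂ (f.act (z : ℂˣ))) '' (unitPart ℂ '' T) := by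
  rw [Set.image_image, Set.image_image]
  exact Set.image_congr fun u _ => unitPart_galAct _ u

/-- The twist `z ↦ f(z)/|f(z)|` on `O_ℂ^×` is multiplicative. [cite: MochizukiFrdII2008, Def 3.1 (iv) p.24] -/
theorem twist_mul {L K : D0} (f : L ⟶ K) (z w : normOneSubgroup ℂ) :
    unitPart ℂ (f.act ((z * w : normOneSubgroup ℂ) : ℂˣ)) =
      unitPart ℂ (f.act (z : ℂˣ)) * unitPart ℂ (f.act (w : ℂˣ)) := by
  rw [Subgroup.coe_mul, map_mul, unitPart_mul]

/-- The twist on `O_ℂ^×` is an involution. [cite: MochizukiFrdII2008, Def 3.1 (iv) p.24] -/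
theorem twist_twist {L K : D0} (f : L ⟶ K) (z : normOneSubgroup ℂ) :
    unitPart ℂ (f.act ((unitPart ℂ (f.act (z : ℂˣ))) : ℂˣ)) = z := by
  rw [← unitPart_galAct, D0.galAct_galAct, unitPart_normOne_coe]

/-- The twist on `O_ℂ^×` is injective. [cite: MochizukiFrdII2008, Def 3.1 (iv) p.24] -/
theorem twist_injective {L K : D0} (f : L ⟶ K) :
    Function.Injective fun z : normOneSubgroup ℂ => unitPart ℂ (f.act (z : ℂˣ)) := by
  intro z w h
  have := congrArg (fun x : normOneSubgroup ℂ => unitPart ℂ (f.act (x : ℂˣ))) h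
  simpa only [twist_twist] using this

/-- The twist of a translate: `τ(w · B) = τ(w) · τ(B)`. [cite: MochizukiFrdII2008, Def 3.1 (iv) p.24] -/
theorem twist_image_smul {L K : D0} (f : L ⟶ K) (w : normOneSubgroup ℂ) (B : Set (normOneSubgroup ℂ)) :
    (fun z : normOneSubgroup ℂ => unitPart ℂ (f.act (z : ℂˣ))) '' (w • B) =
      unitPart ℂ (f.act (w : ℂˣ)) • (fun z : normOneSubgroup ℂ => unitPart ℂ (f.act (z : ℂˣ))) '' B := by
  rw [← Set.image_smul, ← Set.image_smul, Set.image_image, Set.image_image]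
  exact Set.image_congr fun z _ => twist_mul f w z

/-! ### Shadows of images of morphisms -/

/-- The angular part of `Im(A_L^{⊗d})` is `(c/|c|) · B^d`. [cite: MochizukiFrdII2008, Ex 3.3 (i) p.28] -/
theorem image_unitPart_homImage (φ : X ⟶ Y) :
    unitPart ℂ '' Hom.image φ = unitPart ℂ (scalar φ) • X.region.dir ^ (degFr φ : ℕ) := by
  unfold Hom.image
  rw [← (Hom.degFr φ).natPred_add_one]
  exact X.region.image_unitPart_smul_carrier_pow _ _

/-- The angular part of `A_K|_L` is the Galois twist of that of `A_K`.
[cite: MochizukiFrdII2008, Def 3.1 (iv) p.24] -/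
theorem image_unitPart_pullRegion (Y : C0) {L : D0} (f : L ⟶ Y.base) :
    unitPart ℂ '' pullRegion Y f =
      (fun z : normOneSubgroup ℂ => unitPart ℂ (f.act (z : ℂˣ))) '' Y.region.dir := by
  unfold pullRegion
  rw [image_unitPart_act_image, Y.region.image_unitPart_carrier]

/-- `Im` of a composite: `Im(χ ∘ ψ) = Base(ψ)(c_χ) · Im(ψ)^{deg_Fr χ}`.
[cite: MochizukiFrdII2008, Ex 3.3 (i) p.27] -/
theorem homImage_comp (ψ : X ⟶ Y) (χ : Y ⟶ Z) :
    Hom.image (ψ ≫ χ) = (Base ψ).act (scalar χ) • Hom.image ψ ^ (degFr χ : ℕ) := by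
  unfold Hom.image
  change ((Base ψ).act (scalar χ) * scalar ψ ^ (degFr χ : ℕ)) • X.region.carrier ^
      ((degFr ψ * degFr χ : ℕ+) : ℕ) = _
  rw [PNat.mul_coe, pow_mul, smul_set_pow', mul_smul]

/-- `Im(χ ∘ ψ) ⊆ Base(ψ)-twist of Im(χ)` (since `Im(ψ) ⊆ A|_{Base ψ}`).
[cite: MochizukiFrdII2008, Ex 3.3 (i) p.27] -/
theorem homImage_comp_subset (ψ : X ⟶ Y) (χ : Y ⟶ Z) :
    Hom.image (ψ ≫ χ) ⊆ (Base ψ).act '' Hom.image χ := by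
  rw [homImage_comp]
  unfold Hom.image
  rw [act_image_smul, Set.image_pow]
  exact Set.smul_set_mono (Set.pow_subset_pow_left ψ.mapsTo)

/-- The shadow of a composite, upper bound: `(Im(χ∘ψ))/|·| ⊆ τ_ψ((Im χ)/|·|)`.
[cite: MochizukiFrdII2008, Ex 3.3 (ii) p.28] -/
theorem shadow_comp_subset (ψ : X ⟶ Y) (χ : Y ⟶ Z) :
    unitPart ℂ '' Hom.image (ψ ≫ χ) ⊆
      (fun z : normOneSubgroup ℂ => unitPart ℂ ((Base ψ).act (z : ℂˣ))) '' (unitPart ℂ '' Hom.image χ) := by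
  rw [← image_unitPart_act_image]
  exact Set.image_mono (homImage_comp_subset ψ χ)

/-- The shadow of the target of a composite: `(A|_{Base(χ∘ψ)})/|·| = τ_ψ((A|_{Base χ})/|·|)`.
[cite: MochizukiFrdII2008, Def 3.1 (iv) p.24] -/
theorem shadow_pullRegion_comp (ψ : X ⟶ Y) (χ : Y ⟶ Z) :
    unitPart ℂ '' pullRegion Z (Base (ψ ≫ χ)) =
      (fun z : normOneSubgroup ℂ => unitPart ℂ ((Base ψ).act (z : ℂˣ))) ''
        (unitPart ℂ '' pullRegion Z (Base χ)) := by
  rw [base_comp', pullRegion_comp, image_unitPart_act_image]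

/-- The shadow of a composite with a linear second factor: `(Im(χ∘ψ))/|·| = τ_ψ(c_χ/|c_χ|) · (Im ψ)/|·|`.
[cite: MochizukiFrdII2008, Ex 3.3 (ii) p.28] -/
theorem shadow_comp_of_linear (ψ : X ⟶ Y) (χ : Y ⟶ Z) (hχ : degFr χ = 1) :
    unitPart ℂ '' Hom.image (ψ ≫ χ) =
      unitPart ℂ ((Base ψ).act (scalar χ)) • unitPart ℂ '' Hom.image ψ := by
  rw [homImage_comp, hχ, PNat.one_coe, pow_one, image_unitPart_smul]

/-! ### Isotropic ⟺ naively isotropic -/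

/-- An isometric pre-step of `C₀` is an isomorphism iff its shadow fills the target's.
[cite: MochizukiFrdII2008, Ex 3.3 (ii) p.28] -/
theorem isIso_iff_shadow_eq (β : X ⟶ Y) (hpre : PreFrobenioid.IsPreStep toElem β)
    (hiso : PreFrobenioid.IsIsometry toElem β) :
    IsIso β ↔ unitPart ℂ '' Hom.image β = unitPart ℂ '' pullRegion Y (Base β) := by
  constructor
  · intro h
    obtain ⟨-, hd, hfull⟩ := of_isIso β
    rw [image_unitPart_homImage, hd, PNat.one_coe, pow_one, ← X.region.image_unitPart_carrier,
      ← image_unitPart_smul, hfull]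
  · intro h
    obtain ⟨A', hA'c, hA't, -, -⟩ := exists_pulledRegion Y (Base β)
    refine isIso_of_isometry_of_dir β hpre hiso hA'c hA't ?_
    have hd : degFr β = 1 := hpre.1
    rw [← A'.image_unitPart_carrier, hA'c, ← h, image_unitPart_homImage, hd, PNat.one_coe,
      pow_one]

/-- A naively isotropic object is isotropic ([FrdI] Def. 1.2 (iv)): every isometric pre-step out of
it is an isomorphism ("`Ü`nit parts fill the circle"). [cite: MochizukiFrdII2008, Ex 3.3 (ii) p.28] -/
theorem isIsotropic_of_isNaivelyIsotropic (hX : X.IsNaivelyIsotropic) :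
    PreFrobenioid.IsIsotropic toElem X := by
  intro B β hiso hpre
  rw [isIso_iff_shadow_eq β hpre hiso]
  refine le_antisymm (Set.image_mono β.mapsTo) ?_
  have hd : degFr β = 1 := hpre.1
  rw [image_unitPart_homImage, show X.region.dir = univ from hX, hd, PNat.one_coe, pow_one,
    Set.smul_set_univ]
  exact Set.subset_univ _

/-- **Ex. 3.3 (ii), first claim, for `C₀`**: an object is isotropic in the sense of [FrdI]
Def. 1.2 (iv) iff it is naively isotropic. [cite: MochizukiFrdII2008, Ex 3.3 (ii) p.28] -/
theorem isIsotropic_iff_isNaivelyIsotropic (X : C0) :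
    PreFrobenioid.IsIsotropic toElem X ↔ X.IsNaivelyIsotropic := by
  refine ⟨fun h => ?_, isIsotropic_of_isNaivelyIsotropic⟩
  -- the arrow `(𝟙, 1, 1) : X → (X.base, S¹ × (0, tip])` is an isometric pre-step, hence an iso
  obtain ⟨A, hAd, hAt⟩ := exists_angularRegion isOpen_univ isConnected_univ_normOne X.region.tip
  let X' : C0 := ⟨X.base, A, fun _ => hAd⟩
  obtain ⟨A', hA'c, hA't, -, hA'i⟩ := exists_pulledRegion X' (𝟙 X.base)
  have hA'd : A'.dir = univ := hA'i hAd
  obtain ⟨φ, hφb, hφd, hφc⟩ := exists_hom X X' (𝟙 X.base) 1 (one_mem _) hA'c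
    (by rw [hA'd]; exact Set.subset_univ _)
    (by rw [hA't, Units.val_one, norm_one, one_mul, PNat.one_coe, pow_one]
        show X.tip ≤ (A.tip : ℝ); rw [hAt]; exact le_rfl)
  have hpre : PreFrobenioid.IsPreStep toElem φ :=
    ⟨hφd, by rw [isBaseIso_iff, hφb]; infer_instance⟩
  have hisom : PreFrobenioid.IsIsometry toElem φ := by
    rw [isIsometry_iff, hφc, hφd, Units.val_one, norm_one, one_mul, PNat.one_coe, pow_one]
    show X.tip = (A.tip : ℝ); rw [hAt]; rfl
  haveI := h φ hisom hpre
  obtain ⟨-, -, hfull⟩ := of_isIso φ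
  have := congrArg (Set.image (unitPart ℂ)) hfull
  rw [image_unitPart_smul, X.region.image_unitPart_carrier, hφb, ← hA'c, A'.image_unitPart_carrier,
    hA'd, hφc, unitPart_one, one_smul] at this
  exact this

/-- Real objects are isotropic. [cite: MochizukiFrdII2008, Ex 3.3 (ii) p.28] -/
theorem isIsotropic_of_isRealObj (hX : X.IsRealObj) : PreFrobenioid.IsIsotropic toElem X :=
  isIsotropic_of_isNaivelyIsotropic (isNaivelyIsotropic_of_isRealObj hX)

/-- An arrow of `D₀` out of `Spec ℝ` lands in `Spec ℝ`. [cite: MochizukiFrdII2008, §3 p.23] -/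
theorem _root_.Literature.AlgebraicGeometry.Frobenioids.ArchFrd.D0.eq_real_of_hom_real
    {K : D0} (f : D0.real ⟶ K) : K = D0.real := by
  cases K
  · rfl
  · exact (D0.isEmpty_hom_real_complex.false f).elim

/-- The codomain of an arrow out of a real object is real. [cite: MochizukiFrdII2008, Ex 3.3 (i) p.27] -/
theorem isRealObj_of_hom (φ : X ⟶ Y) (hX : X.IsRealObj) : Y.IsRealObj := by
  have f := Base φ
  rw [show X.base = D0.real from hX] at f
  exact D0.eq_real_of_hom_real f

/-! ### Co-angular ⟺ naively co-angular -/

/-- A strict inclusion of shadows survives the twist-and-translate of a linear post-composition.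
[cite: MochizukiFrdII2008, Ex 3.3 (ii) p.28] -/
theorem shadow_ssubset_of_comp (β : X ⟶ Y) (α : Y ⟶ Z) (hα : degFr α = 1)
    (h : unitPart ℂ '' Hom.image β ⊂ unitPart ℂ '' pullRegion Y (Base β)) :
    unitPart ℂ '' Hom.image (β ≫ α) ⊂ unitPart ℂ '' pullRegion Z (Base (β ≫ α)) := by
  rw [shadow_comp_of_linear β α hα]
  have h' : unitPart ℂ ((Base β).act (scalar α)) • unitPart ℂ '' Hom.image β ⊂
      unitPart ℂ ((Base β).act (scalar α)) • unitPart ℂ '' pullRegion Y (Base β) :=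
    ⟨Set.smul_set_mono h.1, fun hle => h.2 (Set.smul_set_subset_smul_set_iff.mp hle)⟩
  refine lt_of_lt_of_le h' ?_
  -- `τ_β(c_α) · (A_Y|_{Base β})/|·| = τ_β((c_α A_Y)/|·|) ⊆ τ_β((A_Z|_{Base α})/|·|)`
  have hα' : scalar α • Y.region.carrier ⊆ pullRegion Z (Base α) := by
    have := α.mapsTo
    change scalar α • Y.region.carrier ^ (degFr α : ℕ) ⊆ _ at this
    rwa [hα, PNat.one_coe, pow_one] at this
  rw [unitPart_galAct, image_unitPart_pullRegion Y (Base β),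
    ← twist_image_smul (Base β) (unitPart ℂ (scalar α)) Y.region.dir, shadow_pullRegion_comp β α,
    ← Y.region.image_unitPart_carrier, ← image_unitPart_smul]
  exact Set.image_mono (Set.image_mono hα')

/-- **Naively co-angular ⇒ co-angular** ([FrdI] Def. 1.2 (iii)): in a factorisation
`φ = α ∘ β ∘ γ` with `β` an isometric pre-step, a non-invertible `β` would have a shadow strictly
smaller than its target's, and this strictness propagates to `φ`.
[cite: MochizukiFrdII2008, Ex 3.3 (ii) p.28] -/
theorem isCoAngular_of_isNaivelyCoAngular (φ : X ⟶ Y) (h : IsNaivelyCoAngular φ) :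
    PreFrobenioid.IsCoAngular toElem φ := by
  intro X₁ X₂ γ β α hfac hα hβi hβp _
  by_contra hβ
  -- `β` is not an isomorphism: strict shadow inclusion
  have hss : unitPart ℂ '' Hom.image β ⊂ unitPart ℂ '' pullRegion X₂ (Base β) :=
    Set.ssubset_iff_subset_ne.mpr ⟨Set.image_mono β.mapsTo,
      fun e => hβ ((isIso_iff_shadow_eq β hβp hβi).mpr e)⟩
  rcases D0.isReal_or_isComplex X.base with hX | hX
  · -- real domain: `X₁` is real, hence isotropic, so `β` is an iso after all
    exact hβ (isIsotropic_of_isRealObj (isRealObj_of_hom γ hX) β hβi hβp)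
  · have hss' := shadow_ssubset_of_comp β α hα hss
    -- push through `γ`
    have hsub : unitPart ℂ '' Hom.image φ ⊆
        (fun z : normOneSubgroup ℂ => unitPart ℂ ((Base γ).act (z : ℂˣ))) ''
          (unitPart ℂ '' Hom.image (β ≫ α)) := by
      rw [← hfac]; exact shadow_comp_subset γ (β ≫ α)
    have htarget : unitPart ℂ '' pullRegion Y (Base φ) =
        (fun z : normOneSubgroup ℂ => unitPart ℂ ((Base γ).act (z : ℂˣ))) ''
          (unitPart ℂ '' pullRegion Y (Base (β ≫ α))) := by
      rw [← hfac]; exact shadow_pullRegion_comp γ (β ≫ α)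
    have hne : unitPart ℂ '' Hom.image φ ≠ unitPart ℂ '' pullRegion Y (Base φ) := by
      intro e
      apply hss'.2
      rw [← Set.image_subset_image_iff (twist_injective (Base γ)), ← htarget, ← e]
      exact hsub
    exact hne (h hX)

end C0

end ArchFrd

end

end Literature.AlgebraicGeometry.Frobenioids
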